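import Mathlib.Analysis.Calculus.LineDeriv.IntegrationByParts
import Mathlib.Analysis.Calculus.FDeriv.Symmetric
import Literature.Analysis.FluidPDE.VortexFilament.TestField
import Literature.Analysis.FluidPDE.VortexFilament.Kernel

/-!
# Curl energy of the test field, I: integration by parts

Support file for the proof of the Jerrard–Seis energy lower bound
(`Literature.Analysis.FluidPDE.VortexFilament.JerrardSeis2016_filamentEnergyLowerBound`).
For the test field `ξ = F ∗ μ_Γ` (`TestField.lean`) built on the radial `C²` kernel of
`Kernel.lean`, this file proves
`∫ |curl ξ|² dx ≤ ∫∫ (−ΔF)(x − γ(s)) ⟪ξ(x), γ'(s)⟫ ds dx` (`integral_norm_sq_curl_le`).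

## Contents

* `integral_mul_eq_neg_of_hasLineDerivAt`: integration by parts along a coordinate direction
  on `ℝ³` (Mathlib's `integral_bilinear_hasLineDerivAt_right_eq_neg_left_of_integrable`) for
  continuous functions, one factor compactly supported.
* `testField_derivatives`: the Jacobian `∂ⱼξ_k` and the second derivatives `∂ᵢ∂ⱼξ_k` of the test
  field as smears of `∂ⱼF` and `∂ᵢ∂ⱼF` (differentiation under the integral twice), their
  continuity, compact support, symmetry in `i, j`, and `Σⱼ ∂ⱼ∂ⱼ ξ_k(x) = ∫ γ'_k ΔF(x − γ(s)) ds`.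
* `integral_norm_sq_curl_le`: `∫ |curl ξ|² = ∫ |∇ξ|² − ∫ (div ξ)² ≤ ∫ |∇ξ|² = ⟨ξ, −Δξ⟩`, the
  classical identity obtained from two integrations by parts, written out in coordinates.

This replaces, in the duality form of the argument, the computation of `‖v^ε‖²_{L²}` for the
prototype velocity field in [JerrardSeis2016, Prop. 1, §4.5]. No definitions are introduced.
-/

noncomputable section

open MeasureTheory Set Filter Function Metric
open scoped Topology InnerProductSpace RealInnerProductSpace ENNReal NNReal

namespace Literature.Analysis.FluidPDE

namespace VortexFilament

/-! ### Integration by parts on `ℝ³` for products of continuous functions -/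

/-- Integration by parts along a coordinate direction for continuous functions, one factor (and
its derivative) having compact support: `∫ f g' = −∫ f' g`. [folklore] -/
theorem integral_mul_eq_neg_of_hasLineDerivAt {f f' g g' : EuclideanSpace ℝ (Fin 3) → ℝ}
    {v : EuclideanSpace ℝ (Fin 3)} (hf : ∀ x, HasLineDerivAt ℝ f (f' x) x v)
    (hg : ∀ x, HasLineDerivAt ℝ g (g' x) x v) (hfc : Continuous f) (hf'c : Continuous f')
    (hgc : Continuous g) (hg'c : Continuous g') (hgs : HasCompactSupport g)
    (hg's : HasCompactSupport g') :
    ∫ x, f x * g' x = -∫ x, f' x * g x := by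
  have h := integral_bilinear_hasLineDerivAt_right_eq_neg_left_of_integrable
    (μ := (volume : Measure (EuclideanSpace ℝ (Fin 3)))) (B := ContinuousLinearMap.mul ℝ ℝ)
    (f := f) (f' := f') (g := g) (g' := g') (v := v) ?_ ?_ ?_ (fun x _ => hf x) (fun x _ => hg x)
  · simpa using h
  · exact (hf'c.mul hgc).integrable_of_hasCompactSupport hgs.mul_left
  · exact (hfc.mul hg'c).integrable_of_hasCompactSupport hg's.mul_left
  · exact (hfc.mul hgc).integrable_of_hasCompactSupport hgs.mul_left

/-! ### The Jacobian and second derivatives of the test field -/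

section Jacobian

variable {L : ℝ} {γ : ℝ → EuclideanSpace ℝ (Fin 3)}

/-- **Derivative package of the test field.** For the test field `ξ = F ∗ μ_Γ` with a `C²`
kernel of the radial form of `exists_kernel`, there are continuous, compactly supported functions
`D j k = ∂_j ξ_k` and `DD i j k = ∂_i ∂_j ξ_k` (line derivatives along the coordinate vectors),
symmetric in `i, j`, with `∑_j DD j j k (x) = ∫ γ'_k(s) ΔF(x − γ(s)) ds` where
`ΔF(w) = 4 q₂(|w|²)|w|² + 6 q₁(|w|²)`. [folklore] -/
theorem testField_derivatives (hγ : IsArclengthLoop L γ) {F : EuclideanSpace ℝ (Fin 3) → ℝ}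
    {q₁ q₂ : ℝ → ℝ} (hF2 : ContDiff ℝ 2 F) (hFs : HasCompactSupport F)
    (hF' : ∀ z : EuclideanSpace ℝ (Fin 3), HasFDerivAt F ((2 * q₁ (‖z‖ ^ 2)) • innerSL ℝ z) z)
    (hG' : ∀ (z : EuclideanSpace ℝ (Fin 3)) (j : Fin 3),
      HasFDerivAt (fun w : EuclideanSpace ℝ (Fin 3) => 2 * q₁ (‖w‖ ^ 2) * w j)
        ((2 * q₁ (‖z‖ ^ 2)) • innerSL ℝ (EuclideanSpace.single j (1:ℝ)) +
          (z j) • ((4 * q₂ (‖z‖ ^ 2)) • innerSL ℝ z)) z)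
    (hq₁ : Continuous q₁) (hq₂ : Continuous q₂)
    {ξ : EuclideanSpace ℝ (Fin 3) → EuclideanSpace ℝ (Fin 3)}
    (hξ : ξ = fun x => ∫ s in Ico 0 L, F (x - γ s) • deriv γ s) :
    ∃ (D : Fin 3 → Fin 3 → EuclideanSpace ℝ (Fin 3) → ℝ)
      (DD : Fin 3 → Fin 3 → Fin 3 → EuclideanSpace ℝ (Fin 3) → ℝ),
      (∀ j k x, fderiv ℝ ξ x (EuclideanSpace.single j 1) k = D j k x) ∧
      (∀ j k x, HasLineDerivAt ℝ (fun x => ξ x k) (D j k x) x (EuclideanSpace.single j 1)) ∧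
      (∀ i j k x, HasLineDerivAt ℝ (D j k) (DD i j k x) x (EuclideanSpace.single i 1)) ∧
      (∀ i j k x, DD i j k x = DD j i k x) ∧
      (∀ k x, ∑ j, DD j j k x =
        ∫ s in Ico 0 L, deriv γ s k * (4 * q₂ (‖x - γ s‖ ^ 2) * ‖x - γ s‖ ^ 2 +
          6 * q₁ (‖x - γ s‖ ^ 2))) ∧
      (∀ k, Continuous fun x => ξ x k) ∧ (∀ j k, Continuous (D j k)) ∧
      (∀ i j k, Continuous (DD i j k)) ∧
      (∀ k, HasCompactSupport fun x => ξ x k) ∧ (∀ j k, HasCompactSupport (D j k)) ∧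
      (∀ i j k, HasCompactSupport (DD i j k)) := by
  have hγc : Continuous γ := hγ.lipschitz.continuous
  have hF1 : ContDiff ℝ 1 F := hF2.of_le (by norm_num)
  have hFc : Continuous F := hF2.continuous
  -- first partials of the kernel
  set Φ : Fin 3 → EuclideanSpace ℝ (Fin 3) → ℝ := fun j w => fderiv ℝ F w (EuclideanSpace.single j 1)
    with hΦ
  have hΦ_eq : ∀ j w, Φ j w = 2 * q₁ (‖w‖ ^ 2) * w j := by
    intro j w
    simp only [hΦ]
    rw [(hF' w).fderiv, radial_fderiv_apply_single]
  have hΦ_fun : ∀ j, Φ j = fun w => 2 * q₁ (‖w‖ ^ 2) * w j := fun j => funext (hΦ_eq j)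
  have hΦ1 : ∀ j, ContDiff ℝ 1 (Φ j) := by
    intro j
    simp only [hΦ]
    exact (hF2.fderiv_right (m := 1) le_rfl).clm_apply contDiff_const
  have hΦs : ∀ j, HasCompactSupport (Φ j) := fun j => hFs.fderiv_apply (𝕜 := ℝ) _
  have hΦc : ∀ j, Continuous (Φ j) := fun j => (hΦ1 j).continuous
  -- second partials of the kernel
  set Ψ : Fin 3 → Fin 3 → EuclideanSpace ℝ (Fin 3) → ℝ :=
    fun i j w => fderiv ℝ (Φ j) w (EuclideanSpace.single i 1) with hΨ
  have hΨ_eq : ∀ i j w, Ψ i j w =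
      4 * q₂ (‖w‖ ^ 2) * w i * w j + (if i = j then 2 * q₁ (‖w‖ ^ 2) else 0) := by
    intro i j w
    simp only [hΨ]
    rw [hΦ_fun j, (hG' w j).fderiv, radial_fderiv2_apply_single]
  have hΨ_symm : ∀ i j w, Ψ i j w = Ψ j i w := by
    intro i j w
    rw [hΨ_eq, hΨ_eq]
    by_cases h : i = j
    · subst h; rfl
    · rw [if_neg h, if_neg (Ne.symm h)]; ring
  have hΨc : ∀ i j, Continuous (Ψ i j) := by
    intro i j
    have : Ψ i j = fun w => 4 * q₂ (‖w‖ ^ 2) * w i * w j +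
        (if i = j then 2 * q₁ (‖w‖ ^ 2) else 0) := funext (hΨ_eq i j)
    rw [this]
    have h1 : Continuous fun w : EuclideanSpace ℝ (Fin 3) => q₂ (‖w‖ ^ 2) :=
      hq₂.comp (continuous_norm.pow 2)
    have h2 : Continuous fun w : EuclideanSpace ℝ (Fin 3) => q₁ (‖w‖ ^ 2) :=
      hq₁.comp (continuous_norm.pow 2)
    have h3 : ∀ l : Fin 3, Continuous fun w : EuclideanSpace ℝ (Fin 3) => w l :=
      fun l => (EuclideanSpace.proj l).continuous
    split_ifs
    · exact ((continuous_const.mul h1).mul (h3 i)).mul (h3 j) |>.add (continuous_const.mul h2)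
    · exact (((continuous_const.mul h1).mul (h3 i)).mul (h3 j)).add continuous_const
  have hΨs : ∀ i j, HasCompactSupport (Ψ i j) := fun i j => (hΦs j).fderiv_apply (𝕜 := ℝ) _
  have hΨ_lap : ∀ w, ∑ j, Ψ j j w = 4 * q₂ (‖w‖ ^ 2) * ‖w‖ ^ 2 + 6 * q₁ (‖w‖ ^ 2) := by
    intro w
    simp only [hΨ_eq, if_true, Fin.sum_univ_three]
    have : ‖w‖ ^ 2 = w 0 ^ 2 + w 1 ^ 2 + w 2 ^ 2 := by
      rw [EuclideanSpace.real_norm_sq_eq, Fin.sum_univ_three]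
    rw [this]; ring
  -- the tangent weights
  have hτ := fun k => hγ.measurable_deriv_apply k
  -- the Jacobian `D j k = ∂_j ξ_k` and the second derivatives `DD i j k = ∂_i ∂_j ξ_k`
  set D : Fin 3 → Fin 3 → EuclideanSpace ℝ (Fin 3) → ℝ :=
    fun j k x => ∫ s in Ico 0 L, (deriv γ s k) • Φ j (x - γ s) with hD
  set DD : Fin 3 → Fin 3 → Fin 3 → EuclideanSpace ℝ (Fin 3) → ℝ :=
    fun i j k x => ∫ s in Ico 0 L, (deriv γ s k) • Ψ i j (x - γ s) with hDD
  -- `ξ_k` as a smear and its derivative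
  have hξk : ∀ k, (fun x => ξ x k) = fun x => ∫ s in Ico 0 L, (deriv γ s k) • F (x - γ s) := by
    intro k; funext x; rw [hξ]; exact testField_apply hγ hFc hFs x k
  have hξk_deriv : ∀ k x, HasFDerivAt (fun x => ξ x k)
      (∫ s in Ico 0 L, (deriv γ s k) • fderiv ℝ F (x - γ s)) x := by
    intro k x; rw [hξk k]; exact hasFDerivAt_smear hγc hF1 hFs (hτ k).1 (hτ k).2 x
  have hint1 : ∀ k x, Integrable (fun s => (deriv γ s k) • fderiv ℝ F (x - γ s))
      (volume.restrict (Ico 0 L)) := fun k x =>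
    integrable_smear_integrand hγc (hF1.continuous_fderiv one_ne_zero) (hFs.fderiv ℝ)
      (hτ k).1 (hτ k).2 x
  have hD_eq : ∀ j k x, (∫ s in Ico 0 L, (deriv γ s k) • fderiv ℝ F (x - γ s))
      (EuclideanSpace.single j 1) = D j k x := by
    intro j k x
    rw [ContinuousLinearMap.integral_apply (hint1 k x)]
    simp only [hD, hΦ, FunLike.coe_smul, Pi.smul_apply, smul_eq_mul]
  -- `D j k` as a smear of `Φ j` and its derivative
  have hD_deriv : ∀ j k x, HasFDerivAt (D j k)
      (∫ s in Ico 0 L, (deriv γ s k) • fderiv ℝ (Φ j) (x - γ s)) x := by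
    intro j k x
    exact hasFDerivAt_smear hγc (hΦ1 j) (hΦs j) (hτ k).1 (hτ k).2 x
  have hint2 : ∀ j k x, Integrable (fun s => (deriv γ s k) • fderiv ℝ (Φ j) (x - γ s))
      (volume.restrict (Ico 0 L)) := fun j k x =>
    integrable_smear_integrand hγc ((hΦ1 j).continuous_fderiv one_ne_zero) ((hΦs j).fderiv ℝ)
      (hτ k).1 (hτ k).2 x
  have hDD_eq : ∀ i j k x, (∫ s in Ico 0 L, (deriv γ s k) • fderiv ℝ (Φ j) (x - γ s))
      (EuclideanSpace.single i 1) = DD i j k x := by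
    intro i j k x
    rw [ContinuousLinearMap.integral_apply (hint2 j k x)]
    simp only [hDD, hΨ, FunLike.coe_smul, Pi.smul_apply, smul_eq_mul]
  refine ⟨D, DD, ?_, ?_, ?_, ?_, ?_, ?_, ?_, ?_, ?_, ?_, ?_⟩
  · -- components of `fderiv ξ`
    intro j k x
    have hdiff : DifferentiableAt ℝ ξ x :=
      ((contDiff_one_testField hγ hF1 hFs hξ).differentiable one_ne_zero) x
    have h1 := ((EuclideanSpace.proj k : EuclideanSpace ℝ (Fin 3) →L[ℝ] ℝ).hasFDerivAt.comp x
      hdiff.hasFDerivAt)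
    have h2 : HasFDerivAt (fun x => ξ x k)
        ((EuclideanSpace.proj k : EuclideanSpace ℝ (Fin 3) →L[ℝ] ℝ).comp (fderiv ℝ ξ x)) x := h1
    have h3 := (hξk_deriv k x).unique h2
    rw [← hD_eq, h3]
    rfl
  · intro j k x
    have := (hξk_deriv k x).hasLineDerivAt (EuclideanSpace.single j 1)
    rwa [hD_eq] at this
  · intro i j k x
    have := (hD_deriv j k x).hasLineDerivAt (EuclideanSpace.single i 1)
    rwa [hDD_eq] at this
  · intro i j k x
    simp only [hDD]
    congr 1; funext s; rw [hΨ_symm]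
  · intro k x
    simp only [hDD]
    rw [← integral_finsetSum]
    · congr 1; funext s
      rw [← hΨ_lap, Finset.mul_sum]
      simp only [smul_eq_mul]
    · intro j _
      exact integrable_smear_integrand hγc (hΨc j j) (hΨs j j) (hτ k).1 (hτ k).2 x
  · intro k; rw [hξk k]; exact continuous_smear hγc hFc hFs (hτ k).1 (hτ k).2
  · intro j k; exact continuous_smear hγc (hΦc j) (hΦs j) (hτ k).1 (hτ k).2
  · intro i j k; exact continuous_smear hγc (hΨc i j) (hΨs i j) (hτ k).1 (hτ k).2
  · intro k
    obtain ⟨M, hM⟩ := hγ.exists_bound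
    obtain ⟨R, hR⟩ : ∃ R, ∀ z, R < ‖z‖ → F z = 0 := by
      obtain ⟨R, hR⟩ := (hFs.isCompact.isBounded).subset_closedBall 0
      refine ⟨R, fun z hz => ?_⟩
      by_contra h
      have : z ∈ closedBall (0 : EuclideanSpace ℝ (Fin 3)) R := hR (subset_tsupport _ h)
      rw [mem_closedBall_zero_iff] at this
      linarith
    rw [hξk k]; exact hasCompactSupport_smear hR hM _
  · intro j k
    obtain ⟨M, hM⟩ := hγ.exists_bound
    obtain ⟨R, hR⟩ : ∃ R, ∀ z, R < ‖z‖ → Φ j z = 0 := by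
      obtain ⟨R, hR⟩ := ((hΦs j).isCompact.isBounded).subset_closedBall 0
      refine ⟨R, fun z hz => ?_⟩
      by_contra h
      have : z ∈ closedBall (0 : EuclideanSpace ℝ (Fin 3)) R := hR (subset_tsupport _ h)
      rw [mem_closedBall_zero_iff] at this
      linarith
    exact hasCompactSupport_smear hR hM _
  · intro i j k
    obtain ⟨M, hM⟩ := hγ.exists_bound
    obtain ⟨R, hR⟩ : ∃ R, ∀ z, R < ‖z‖ → Ψ i j z = 0 := by
      obtain ⟨R, hR⟩ := ((hΨs i j).isCompact.isBounded).subset_closedBall 0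
      refine ⟨R, fun z hz => ?_⟩
      by_contra h
      have : z ∈ closedBall (0 : EuclideanSpace ℝ (Fin 3)) R := hR (subset_tsupport _ h)
      rw [mem_closedBall_zero_iff] at this
      linarith
    exact hasCompactSupport_smear hR hM _

end Jacobian

/-! ### Integration by parts: the curl energy is dominated by `⟨ξ, −Δξ⟩` -/

section CurlEnergy

variable {L : ℝ} {γ : ℝ → EuclideanSpace ℝ (Fin 3)}

/-- `‖(a, b, c)‖² = a² + b² + c²` in `ℝ³`. [folklore] -/
theorem norm_sq_toLp_three (a b c : ℝ) :
    ‖(WithLp.toLp 2 ![a, b, c] : EuclideanSpace ℝ (Fin 3))‖ ^ 2 = a ^ 2 + b ^ 2 + c ^ 2 := by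
  rw [EuclideanSpace.real_norm_sq_eq, Fin.sum_univ_three]
  simp

/-- **Integration by parts for the curl energy.** For the test field `ξ = F ∗ μ_Γ` with the
radial `C²` kernel, `∫ |curl ξ|² dx ≤ ∫∫ (−ΔF)(x − γ(s)) ⟪ξ(x), γ'(s)⟫ ds dx`: indeed
`∫ |curl ξ|² = ∫ |∇ξ|² − ∫ (div ξ)² ≤ ∫ |∇ξ|² = ⟨ξ, −Δξ⟩` by two integrations by parts
(Mathlib's `integral_bilinear_hasLineDerivAt_right_eq_neg_left_of_integrable` along coordinate
directions) and `Δξ_k(x) = ∫ γ'_k(s) ΔF(x − γ(s)) ds`. [folklore] -/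
theorem integral_norm_sq_curl_le (hγ : IsArclengthLoop L γ) {F : EuclideanSpace ℝ (Fin 3) → ℝ}
    {q₁ q₂ : ℝ → ℝ} (hF2 : ContDiff ℝ 2 F) (hFs : HasCompactSupport F)
    (hF' : ∀ z : EuclideanSpace ℝ (Fin 3), HasFDerivAt F ((2 * q₁ (‖z‖ ^ 2)) • innerSL ℝ z) z)
    (hG' : ∀ (z : EuclideanSpace ℝ (Fin 3)) (j : Fin 3),
      HasFDerivAt (fun w : EuclideanSpace ℝ (Fin 3) => 2 * q₁ (‖w‖ ^ 2) * w j)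
        ((2 * q₁ (‖z‖ ^ 2)) • innerSL ℝ (EuclideanSpace.single j (1:ℝ)) +
          (z j) • ((4 * q₂ (‖z‖ ^ 2)) • innerSL ℝ z)) z)
    (hq₁ : Continuous q₁) (hq₂ : Continuous q₂)
    {ξ : EuclideanSpace ℝ (Fin 3) → EuclideanSpace ℝ (Fin 3)}
    (hξ : ξ = fun x => ∫ s in Ico 0 L, F (x - γ s) • deriv γ s) :
    ∫ x, ‖curl ξ x‖ ^ 2 ≤ ∫ x, ∫ s in Ico 0 L,
      -(4 * q₂ (‖x - γ s‖ ^ 2) * ‖x - γ s‖ ^ 2 + 6 * q₁ (‖x - γ s‖ ^ 2)) * ⟪ξ x, deriv γ s⟫ := by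
  obtain ⟨D, DD, hDξ, hDline, hDDline, hsymm, hlap, hξc, hDc, hDDc, hξs, hDs, hDDs⟩ :=
    testField_derivatives hγ hF2 hFs hF' hG' hq₁ hq₂ hξ
  -- integrability of all the products that occur
  have iDD : ∀ j k j' k', Integrable (fun x => D j k x * D j' k' x) :=
    fun j k j' k' => ((hDc j k).mul (hDc j' k')).integrable_of_hasCompactSupport (hDs j' k').mul_left
  have iξDD : ∀ k i j k', Integrable (fun x => ξ x k * DD i j k' x) :=
    fun k i j k' => ((hξc k).mul (hDDc i j k')).integrable_of_hasCompactSupport (hDDs i j k').mul_left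
  -- integration by parts
  have I1 : ∀ j k, ∫ x, ξ x k * DD j j k x = -∫ x, D j k x * D j k x := fun j k =>
    integral_mul_eq_neg_of_hasLineDerivAt (hDline j k) (hDDline j j k) (hξc k) (hDc j k) (hDc j k)
      (hDDc j j k) (hDs j k) (hDDs j j k)
  have I2 : ∀ j k, ∫ x, ξ x k * DD j k j x = -∫ x, D j k x * D k j x := fun j k =>
    integral_mul_eq_neg_of_hasLineDerivAt (hDline j k) (hDDline j k j) (hξc k) (hDc j k) (hDc k j)
      (hDDc j k j) (hDs k j) (hDDs j k j)
  have I3 : ∀ j k, ∫ x, ξ x k * DD k j j x = -∫ x, D k k x * D j j x := fun j k =>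
    integral_mul_eq_neg_of_hasLineDerivAt (hDline k k) (hDDline k j j) (hξc k) (hDc k k) (hDc j j)
      (hDDc k j j) (hDs j j) (hDDs k j j)
  have I23 : ∀ j k, ∫ x, D j k x * D k j x = ∫ x, D k k x * D j j x := by
    intro j k
    have h2 := I2 j k
    have h3 := I3 j k
    have : (fun x => ξ x k * DD j k j x) = fun x => ξ x k * DD k j j x := by
      funext x; rw [hsymm]
    rw [this] at h2
    linarith
  -- pointwise expansion of `|curl ξ|²`
  have hcurl : ∀ x, ‖curl ξ x‖ ^ 2 =
      (D 1 2 x - D 2 1 x) ^ 2 + (D 2 0 x - D 0 2 x) ^ 2 + (D 0 1 x - D 1 0 x) ^ 2 := by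
    intro x
    unfold curl
    simp only [hDξ]
    exact norm_sq_toLp_three _ _ _
  set A : EuclideanSpace ℝ (Fin 3) → ℝ := fun x => ∑ j, ∑ k, D j k x * D j k x with hA
  set S : EuclideanSpace ℝ (Fin 3) → ℝ := fun x => (D 0 0 x + D 1 1 x + D 2 2 x) ^ 2 with hS
  set P₁ : EuclideanSpace ℝ (Fin 3) → ℝ :=
    fun x => D 0 0 x * D 1 1 x + D 0 0 x * D 2 2 x + D 1 1 x * D 2 2 x with hP₁
  set P₂ : EuclideanSpace ℝ (Fin 3) → ℝ :=
    fun x => D 1 2 x * D 2 1 x + D 2 0 x * D 0 2 x + D 0 1 x * D 1 0 x with hP₂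
  have hpt : (fun x => ‖curl ξ x‖ ^ 2) = fun x => (A x - S x) + 2 * (P₁ x - P₂ x) := by
    funext x
    rw [hcurl x]
    simp only [hA, hS, hP₁, hP₂, Fin.sum_univ_three]
    ring
  have iA : Integrable A := by
    simp only [hA]
    refine integrable_finsetSum _ fun j _ => integrable_finsetSum _ fun k _ => iDD j k j k
  have iS : Integrable S := by
    have : S = fun x => D 0 0 x * D 0 0 x + D 1 1 x * D 1 1 x + D 2 2 x * D 2 2 x +
        2 * (D 0 0 x * D 1 1 x + D 0 0 x * D 2 2 x + D 1 1 x * D 2 2 x) := by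
      funext x; simp only [hS]; ring
    rw [this]
    exact (((iDD 0 0 0 0).add (iDD 1 1 1 1)).add (iDD 2 2 2 2)).add
      ((((iDD 0 0 1 1).add (iDD 0 0 2 2)).add (iDD 1 1 2 2)).const_mul 2)
  have iP₁ : Integrable P₁ := ((iDD 0 0 1 1).add (iDD 0 0 2 2)).add (iDD 1 1 2 2)
  have iP₂ : Integrable P₂ := ((iDD 1 2 2 1).add (iDD 2 0 0 2)).add (iDD 0 1 1 0)
  have hP : ∫ x, P₁ x = ∫ x, P₂ x := by
    simp only [hP₁, hP₂]
    have i1 : Integrable (fun x => D 0 0 x * D 1 1 x + D 0 0 x * D 2 2 x) :=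
      (iDD 0 0 1 1).add (iDD 0 0 2 2)
    have i2 : Integrable (fun x => D 1 2 x * D 2 1 x + D 2 0 x * D 0 2 x) :=
      (iDD 1 2 2 1).add (iDD 2 0 0 2)
    rw [integral_add i1 (iDD 1 1 2 2), integral_add (iDD 0 0 1 1) (iDD 0 0 2 2),
      integral_add i2 (iDD 0 1 1 0), integral_add (iDD 1 2 2 1) (iDD 2 0 0 2)]
    have e1 : ∫ x, D 1 2 x * D 2 1 x = ∫ x, D 1 1 x * D 2 2 x := by
      rw [I23 1 2]; congr 1; funext x; ring
    have e2 : ∫ x, D 2 0 x * D 0 2 x = ∫ x, D 0 0 x * D 2 2 x := I23 2 0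
    have e3 : ∫ x, D 0 1 x * D 1 0 x = ∫ x, D 0 0 x * D 1 1 x := by
      rw [I23 0 1]; congr 1; funext x; ring
    rw [e1, e2, e3]; ring
  have hS0 : 0 ≤ ∫ x, S x := integral_nonneg fun x => by positivity
  -- `∫ |curl ξ|² = ∫ A − ∫ S ≤ ∫ A`
  have hle : ∫ x, ‖curl ξ x‖ ^ 2 ≤ ∫ x, A x := by
    have i1 : Integrable (fun x => A x - S x) := iA.sub iS
    have i2 : Integrable (fun x => 2 * (P₁ x - P₂ x)) := (iP₁.sub iP₂).const_mul 2
    rw [hpt, integral_add i1 i2, integral_sub iA iS, integral_const_mul, integral_sub iP₁ iP₂, hP]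
    linarith
  refine hle.trans (le_of_eq ?_)
  -- `∫ A = −∑ ∫ ξ_k ∂_j∂_j ξ_k = ∫∫ (−ΔF)(x − γ s) ⟪ξ x, γ' s⟫`
  have hA_int : ∫ x, A x = ∑ j, ∑ k, -∫ x, ξ x k * DD j j k x := by
    simp only [hA]
    rw [integral_finsetSum _ (fun j _ => integrable_finsetSum _ fun k _ => iDD j k j k)]
    refine Finset.sum_congr rfl fun j _ => ?_
    rw [integral_finsetSum _ (fun k _ => iDD j k j k)]
    refine Finset.sum_congr rfl fun k _ => ?_
    rw [I1 j k, neg_neg]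
  rw [hA_int]
  -- move the sums inside the integral
  have h1 : ∑ j, ∑ k, -∫ x, ξ x k * DD j j k x = ∫ x, ∑ k, ξ x k * (-∑ j, DD j j k x) := by
    have hg : ∀ k, (fun x => ξ x k * -∑ j, DD j j k x) = fun x => ∑ j, -(ξ x k * DD j j k x) := by
      intro k; funext x; rw [mul_neg, Finset.mul_sum, ← Finset.sum_neg_distrib]
    have iN : ∀ k j, Integrable (fun x => -(ξ x k * DD j j k x)) := fun k j => (iξDD k j j k).neg
    rw [Finset.sum_comm, integral_finsetSum _ (fun k _ => ?_)]
    · refine Finset.sum_congr rfl fun k _ => ?_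
      rw [hg k, integral_finsetSum _ (fun j _ => iN k j)]
      refine Finset.sum_congr rfl fun j _ => ?_
      rw [integral_neg]
    · rw [hg k]; exact integrable_finsetSum _ fun j _ => iN k j
  rw [h1]
  congr 1; funext x
  -- use the Laplacian identity and linearity of the `s`-integral
  have hτ := fun k => hγ.measurable_deriv_apply k
  have hlapc : Continuous fun w : EuclideanSpace ℝ (Fin 3) =>
      4 * q₂ (‖w‖ ^ 2) * ‖w‖ ^ 2 + 6 * q₁ (‖w‖ ^ 2) := by
    have h1 : Continuous fun w : EuclideanSpace ℝ (Fin 3) => q₂ (‖w‖ ^ 2) :=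
      hq₂.comp (continuous_norm.pow 2)
    have h2 : Continuous fun w : EuclideanSpace ℝ (Fin 3) => q₁ (‖w‖ ^ 2) :=
      hq₁.comp (continuous_norm.pow 2)
    fun_prop
  have ik : ∀ k, Integrable (fun s => deriv γ s k *
      (4 * q₂ (‖x - γ s‖ ^ 2) * ‖x - γ s‖ ^ 2 + 6 * q₁ (‖x - γ s‖ ^ 2)))
      (volume.restrict (Ico 0 L)) := by
    intro k
    have hm : AEStronglyMeasurable (fun s => deriv γ s k *
        (4 * q₂ (‖x - γ s‖ ^ 2) * ‖x - γ s‖ ^ 2 + 6 * q₁ (‖x - γ s‖ ^ 2)))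
        (volume.restrict (Ico 0 L)) :=
      (hτ k).1.aestronglyMeasurable.mul
        (hlapc.comp (continuous_const.sub hγ.lipschitz.continuous)).aestronglyMeasurable
    obtain ⟨C, hC⟩ := isCompact_Icc.exists_bound_of_continuousOn
      ((hlapc.comp (continuous_const.sub hγ.lipschitz.continuous)).continuousOn
        (s := Icc (0:ℝ) L))
    refine Integrable.of_bound hm C ?_
    rw [ae_restrict_iff' measurableSet_Ico]
    refine ae_of_all _ fun s hs => ?_
    rw [norm_mul, Real.norm_eq_abs]
    calc |deriv γ s k| * ‖4 * q₂ (‖x - γ s‖ ^ 2) * ‖x - γ s‖ ^ 2 + 6 * q₁ (‖x - γ s‖ ^ 2)‖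
        ≤ 1 * C := mul_le_mul ((hτ k).2 s) (hC s (Ico_subset_Icc_self hs)) (norm_nonneg _)
          zero_le_one
      _ = C := one_mul _
  simp only [hlap]
  rw [Fin.sum_univ_three]
  simp only [← integral_neg, ← integral_const_mul]
  rw [← integral_add, ← integral_add]
  · congr 1; funext s
    have h3 : ∀ u v : EuclideanSpace ℝ (Fin 3), ⟪u, v⟫ = u 0 * v 0 + u 1 * v 1 + u 2 * v 2 :=
      fun u v => by simp [PiLp.inner_apply, Fin.sum_univ_three, mul_comm]
    rw [h3]; ring
  · exact (((ik 0).neg).const_mul _).add (((ik 1).neg).const_mul _)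
  · exact ((ik 2).neg).const_mul _
  · exact ((ik 0).neg).const_mul _
  · exact ((ik 1).neg).const_mul _

end CurlEnergy

end VortexFilament

end Literature.Analysis.FluidPDE
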